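import Summits.CriticalPhenomena.PercolationContinuityZ3.Theorems.PercNearOneGluingNoHeavyLowerTailBlockQ9OneDangerousPort
import HarnessLib

/-!
# `NoHeavyLowerTail` (stmt-CriticalPhenomena-4575) — Kozma–Nitzan Theorem 4 for a glued block with ARBITRARY
# boundary neighbours (relays or Steiner vertices): the `T4` leaf of the exploration certificate for general blocks

Support file (lemma factory `prim-lf-1` gen 7, coupling / BK–Harris technique; `--supports stmt-CriticalPhenomena-4575`).
No definitions, no named facts, no sorries.

`BlockQ9.blockThm4_witness` (seat `prim-hp-1`, file `…BlockQ9OneDangerousPort.lean`) proves Kozma–Nitzan's Theorem 4 in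
(41)-form for a glued ONE-LAYER block `O` (every positive pair leaving `O` ends in the relay set `A`), with the anchor `a`
dominated in the block-deleted graph by every port.  Kozma–Nitzan's Lemma 5 (tree `stub_gluingLemma5`, and the printed
Lemma 5, arXiv:2401.12397 p. 13) needs no relay hypothesis on the comparison vertex, so the one-layer hypothesis can be
dropped provided the domination is asked of EVERY vertex receiving a positive pair from the block:

* `blockThm4_general` — `O` disjoint from `A`, `a, b ∉ O`; if `μ_{kill_O w}(a ↔ b) ≤ μ_{kill_O w}(v ↔ b)` for every
  `v ∉ O` with a positive pair from `O` (relay OR Steiner), then `μ_{glue_O w}(a ↔ b, O ↔ A) ≤ μ_{glue_O w}(O ↔ b)`.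
  The proof is `blockThm4_witness`'s verbatim (σ-layer decomposition `sigmaRec_partition`, layer geometry/law
  `stub_sigmaGeometry` / `stub_sigmaLaw`, null layers `sigmaRec_null`, and `stub_gluingLemma5` on each positive layer with
  ANY member of the layer as comparison vertex); only the use of the one-layer hypothesis to force that member into `A` is gone.

Role (memo `prim-lf-1/EC-NOTE.md`): this is the leaf `T4` of the exploration certificate for Question 9 at a block that has
grown through Steiner vertices (boundary neighbours need not be relays); with `BlockQ9.blockQ9_of_reliableBlock` (L3),
`BlockQ9.blockQ9_of_transfer` (M1) and `UpsetExchange.upsetExchange_block` (UP) all leaves of that certificate are now tree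
theorems for arbitrary blocks.
-/

namespace Summit.CriticalPhenomena.PercolationContinuityZ3.Theorems

open MeasureTheory Set ProbabilityTheory
open Literature.Probability.LatticeModels
open Literature.Probability.Percolation

noncomputable section
open Classical

namespace BlockQ9

variable {n : ℕ}

/-- **Kozma–Nitzan Theorem 4 for a glued block with arbitrary boundary neighbours, (41)-form.**  `O` disjoint from
`A`, `a, b ∉ O`; `a` dominated in `kill_O w` by every vertex `v ∉ O` receiving a positive pair from `O`.  Then
`μ_{glue_O w}(a ↔ b, O ↔ A) ≤ μ_{glue_O w}(O ↔ b)`. [cite: KozmaNitzan2024, Thm. 4 and Lemma 5 (pp. 12–14)] -/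
theorem blockThm4_general (w : Sym2 (Fin n) → unitInterval) (O A : Finset (Fin n)) (a b : Fin n)
    (hOA : Disjoint O A) (haO : a ∉ O) (hbO : b ∉ O)
    (hdom : ∀ v : Fin n, v ∉ O → (∃ o ∈ O, w s(o, v) ≠ 0) →
      (prodBernoulli (fun e : Sym2 (Fin n) => if (∃ x ∈ e, x ∈ O) then 0 else w e)).real (openConn a b) ≤
        (prodBernoulli (fun e : Sym2 (Fin n) => if (∃ x ∈ e, x ∈ O) then 0 else w e)).real (openConn v b)) :
    (prodBernoulli (fun e : Sym2 (Fin n) => if (∀ x ∈ e, x ∈ O) ∧ ¬ e.IsDiag then 1 else w e)).real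
        (openConn a b ∩ ⋃ o ∈ O, ⋃ x ∈ A, openConn o x) ≤
      (prodBernoulli (fun e : Sym2 (Fin n) => if (∀ x ∈ e, x ∈ O) ∧ ¬ e.IsDiag then 1 else w e)).real
        (⋃ o ∈ O, openConn o b) := by
  classical
  set g : Sym2 (Fin n) → unitInterval := fun e => if (∀ x ∈ e, x ∈ O) ∧ ¬ e.IsDiag then 1 else w e with hg
  set k : Sym2 (Fin n) → unitInterval := fun e => if (∃ x ∈ e, x ∈ O) then 0 else w e with hk
  -- layer decomposition of both sides
  rw [sigmaRec_partition g O (openConn a b ∩ _), sigmaRec_partition g O (⋃ o ∈ O, openConn o b)]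
  refine Finset.sum_le_sum fun S _ => ?_
  set L : Set (BondConfig (Fin n)) := {ω | ∀ x : Fin n, x ∈ S ↔ (x ∉ O ∧ ∃ o ∈ O, s(o, x) ∈ ω)} with hL
  set Ψ : BondConfig (Fin n) → BondConfig (Fin n) := fun ω =>
    ({e | e ∈ ω ∧ ∀ x ∈ e, x ∉ O} ∪ {e | (∀ x ∈ e, x ∈ S) ∧ ¬ e.IsDiag} : BondConfig (Fin n)) with hΨ
  set gS : Sym2 (Fin n) → unitInterval := fun e =>
    if (∀ x ∈ e, x ∈ S) ∧ ¬ e.IsDiag then 1 else if (∃ x ∈ e, x ∈ O) then 0 else w e with hgS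
  -- internal pairs of `O` are a.s. open under the glued weights
  set K : Set (BondConfig (Fin n)) := {ω | ∀ o ∈ O, ∀ o' ∈ O, o ≠ o' → s(o, o') ∈ ω} with hK
  have hKc : prodBernoulli g Kᶜ = 0 := by
    refine sigmaRec_conull g K fun ω hω => ?_
    simp only [hK, mem_setOf_eq, not_forall] at hω
    obtain ⟨o, ho, o', ho', hne, hclosed⟩ := hω
    refine ⟨s(o, o'), ?_, hclosed⟩
    simp only [hg]
    rw [if_pos ⟨fun x hx => by rcases Sym2.mem_iff.1 hx with rfl | rfl <;> assumption,
      by rw [Sym2.mk_isDiag_iff]; exact hne⟩]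
  -- geometry on `L ∩ K`
  have hgeomA : ∀ ω, ω ∈ L → ω ∈ K →
      (ω ∈ (openConn a b ∩ ⋃ o ∈ O, ⋃ x ∈ A, openConn o x : Set (BondConfig (Fin n))) ↔
        ω ∈ Ψ ⁻¹' (openConn a b ∩ ⋃ s ∈ S, ⋃ x ∈ A, openConn s x)) := by
    intro ω hωL hωK
    obtain ⟨h1, h2⟩ := stub_sigmaGeometry n O S ω hωL hωK
    simp only [mem_preimage, mem_inter_iff]
    exact and_congr (h2 a b haO hbO) (h1 A hOA)
  have hgeomB : ∀ ω, ω ∈ L → ω ∈ K →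
      (ω ∈ (⋃ o ∈ O, openConn o b : Set (BondConfig (Fin n))) ↔ ω ∈ Ψ ⁻¹' (⋃ s ∈ S, openConn s b)) := by
    intro ω hωL hωK
    obtain ⟨h1, -⟩ := stub_sigmaGeometry n O S ω hωL hωK
    have hOb : Disjoint O {b} := Finset.disjoint_singleton_right.2 hbO
    have := h1 {b} hOb
    simp only [Finset.mem_singleton, iUnion_iUnion_eq_left] at this
    simpa only [mem_preimage] using this
  -- null layers: some `x ∈ S` receives no positive pair from `O` (in particular `x ∈ O` or `x ∉ A`)
  by_cases hgen : ∀ x ∈ S, x ∉ O ∧ ∃ o ∈ O, w s(o, x) ≠ 0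
  swap
  · have hL0 : (prodBernoulli g).real L = 0 := by
      push Not at hgen
      obtain ⟨x, hxS, hx⟩ := hgen
      by_cases hxO : x ∈ O
      · have hLe : L = ∅ := by
          ext ω
          simp only [hL, mem_setOf_eq, mem_empty_iff_false, iff_false]
          intro h
          exact ((h x).1 hxS).1 hxO
        rw [hLe, measureReal_empty]
      · refine sigmaRec_null g L (O.image fun o => s(o, x)) (fun e he => ?_) (fun ω hω => ?_)
        · obtain ⟨o, ho, rfl⟩ := Finset.mem_image.1 he
          have hw0 : w s(o, x) = 0 := hx hxO o ho
          have hnot : ¬ ((∀ y ∈ s(o, x), y ∈ O) ∧ ¬ (s(o, x)).IsDiag) := fun h =>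
            hxO (h.1 x (Sym2.mem_mk_right o x))
          simp only [hg]
          rw [if_neg hnot, hw0]
        · obtain ⟨-, o, ho, hox⟩ := ((hω : ω ∈ L) x |>.1) hxS
          exact ⟨s(o, x), Finset.mem_image.2 ⟨o, ho, rfl⟩, hox⟩
    calc (prodBernoulli g).real (L ∩ (openConn a b ∩ ⋃ o ∈ O, ⋃ x ∈ A, openConn o x))
        ≤ (prodBernoulli g).real L := measureReal_mono inter_subset_left
      _ = 0 := hL0
      _ ≤ _ := measureReal_nonneg
  rw [sigmaRec_inter_congr g hKc hgeomA, sigmaRec_inter_congr g hKc hgeomB]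
  -- the empty layer: `O` is isolated, the left event is empty
  rcases S.eq_empty_or_nonempty with hSe | hSne
  · have h0 : Ψ ⁻¹' (openConn a b ∩ ⋃ s ∈ S, ⋃ x ∈ A, (openConn s x : Set (BondConfig (Fin n)))) = ∅ := by
      rw [hSe]; ext ω; simp
    rw [h0, inter_empty, measureReal_empty]
    exact measureReal_nonneg
  -- the layer law
  have hlawA := stub_sigmaLaw n w O S (openConn a b ∩ ⋃ s ∈ S, ⋃ x ∈ A, openConn s x)
  have hlawB := stub_sigmaLaw n w O S (⋃ s ∈ S, openConn s b)
  change (prodBernoulli g).real (L ∩ Ψ ⁻¹' _) = (prodBernoulli g).real L * (prodBernoulli gS).real _ at hlawA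
  change (prodBernoulli g).real (L ∩ Ψ ⁻¹' _) = (prodBernoulli g).real L * (prodBernoulli gS).real _ at hlawB
  rw [hlawA, hlawB]
  refine mul_le_mul_of_nonneg_left ?_ measureReal_nonneg
  -- the layer inequality in the world `glue_S (kill_O w)`
  by_cases hbS : b ∈ S
  · have h1 : (prodBernoulli gS).real (⋃ s ∈ S, openConn s b) = 1 := by
      have : (⋃ s ∈ S, openConn s b : Set (BondConfig (Fin n))) = univ :=
        eq_univ_of_forall fun ω => mem_iUnion₂.2
          ⟨b, hbS, (SimpleGraph.Reachable.refl b : (openGraph ω).Reachable b b)⟩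
      rw [this, probReal_univ]
    rw [h1]; exact measureReal_le_one
  obtain ⟨v, hvS⟩ := hSne
  obtain ⟨hvO, hport⟩ := hgen v hvS
  have h5 := stub_gluingLemma5 n k S a v b hvS hbS (hdom v hvO hport)
  exact (measureReal_mono inter_subset_left).trans h5

end BlockQ9

end

end Summit.CriticalPhenomena.PercolationContinuityZ3.Theorems
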